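import Summits.KontsevichZagierPeriods.KontsevichZagierPeriods.Theorems.RootDecompWalshStrataBallEdges

/-!
# Ball-cube descent 5/7: the two boundary terms are in the Baker sector

Gen 5 of the decomposition node `WalshStrata` (route `RootDecompWalshStrata`, support item
`QuadricBakerDescent` stmt-KontsevichZagierPeriods-27597, its `d = 3` slice): the first two-variable
`√(quadratic)` weight over CUBE-CUT cells decided inside KZ's rules (1)–(3) over `ℚ` —
`sqrtDescent₂_ball : ∀ γ, SqrtDescent₂ K₇ γ` (part 6) for the ball quadric `P = 7/4 − x² − y² − z²`
(`D = 7 − 4x² − 4y²`; atoms = the disc `x² + y² < 3/4` and the annulus `3/4 < x² + y² < 7/4` cut by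
the faces `x = 1`, `y = 1`, plus null/empty/zero-weight atoms), and the corollary
`ballCube_bakerDescent` (part 7): `(d, P, q) = (3, 7/4 − Σxᵢ², q)` is an instance of
`QuadricBakerDescent` for every `q ∈ ℚ`.  Mechanism: the fibrewise vertex chart
`(v, x) ↦ (x, s(x)·v/(1 + v²))`, `s = √(7 − 4x²)`, makes `√D·|det| = (7 − 4x²)(1 − v²)²/(1 + v²)³`
RATIONAL; Newton–Leibniz in `x` over an arbitrary semialgebraic base (the landed band identity); the
`√(7 − 4x²)`-CANCELLATION on the algebraic edges `x² = β(v)` (circle) and `x² = α(v)` (face `y = 1`)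
under the charts `v₁ = 2p/(s + 2)`, `v₂ = 2/(s + 2p)` (`p = √(3/4 − x²)`) reduces both boundary terms to
`E(x²)·√(3/4 − x²)`, `E ∈ ℚ(X)`, hence to rational integrands by the Euler chart of `x² + y² = 3/4`.
This part: `E₁`, `E₃ ∈ ℚ(X)` and their values along the Euler chart, `inBaker_T₁` (circle edge term
`[W ⊆ V₁, F(√β(v), v)]`) and `inBaker_T₃` (face edge term `[W ⊆ V₃, F(√α(v), v)]`) by `exists_cov₁`
along `v₁`/`v₂` followed by `inBaker_of_euler34`; `inBaker_of_chF_one_sub` (the rational upper-edge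
term `F(1, v) = (17c/3)g(v)`).  Imports: part 4; 0 sorry. [this node, gen 5]
-/

noncomputable section

open Literature.NumberTheory.Transcendental
open MeasureTheory Set
open MvPolynomial (aeval X C)
open Literature.ModelTheory.ExponentialFields (IsSemialgebraic isSemialgebraic_univ
  isSemialgebraic_setOf_eval_pos isSemialgebraic_setOf_eval_lt isSemialgebraic_setOf_eval_le
  isSemialgebraic_setOf_eval_nonneg isSemialgebraic_setOf_eval_eq_zero continuous_aeval_real
  tarski_seidenberg_real_holds)
open Summit.KontsevichZagierPeriods.RootDecompWalshStrata.WalshSpanProof (isSemialgebraic_cubeSet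
  isBounded_cubeSet)
open Summit.KontsevichZagierPeriods.RootDecompWalshStrata.ConeSpecimen (unitIoo isSemialgebraic_unitIoo
  unitIoo_subset_Icc mem_unitIoo)
open Summit.KontsevichZagierPeriods.RootDecompWalshStrata.PointlessOctant (boxTwo isSemialgebraic_boxTwo
  boxTwo_subset_Icc euler_inj)

namespace Summit.KontsevichZagierPeriods.RootDecompWalshStrata.ConicDescent.BallCube

/-! #### 23.10 The two boundary terms are in the Baker sector -/

/-- The constant `1` is `ℚ`-semialgebraic on a `ℚ`-semialgebraic set (file-local copy). [BCR1998 §2.2] -/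
private theorem isSemialgebraicFunOn_one {N : ℕ} {X : Set (Fin N → ℝ)} (hX : IsSemialgebraic ℚ X) :
    IsSemialgebraicFunOn ℚ X fun _ => (1 : ℝ) :=
  (isSemialgebraicFunOn_ratCast hX 1).congr fun _ _ => Rat.cast_one

/-- `E₁(c, X) = 8cX(7 − 4X/3)/((7 − 4X)²(3/4 − X))` (`X = x²`): the circle term pulled back by
`v₁` is `E₁(c, x²)·√(3/4 − x²)`. -/
def E₁ (c : ℚ) (X : ℝ) : ℝ := 8 * (c : ℝ) * X * (7 - 4 / 3 * X) / ((7 - 4 * X) ^ 2 * (3 / 4 - X))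

/-- `E₃(c, X) = 8cX(7 − 4X/3)/(7 − 4X)²`: the face term pulled back by `v₂` is
`E₃(c, x²)·√(3/4 − x²)`. -/
def E₃ (c : ℚ) (X : ℝ) : ℝ := 8 * (c : ℝ) * X * (7 - 4 / 3 * X) / (7 - 4 * X) ^ 2

/-- Along the Euler chart (`X = 3W²/4`, `W = (1 − w²)/(1 + w²)`):
`E₁·6w²/(1 + w²)³ = 12c(1 − w²)²(7(1 + w²)² − (1 − w²)²)/((7(1 + w²)² − 3(1 − w²)²)²(1 + w²))`. -/
theorem E₁_euler (c : ℚ) {w : ℝ} (hw0 : 0 < w) :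
    E₁ c (3 / 4 * ((1 - w ^ 2) / (1 + w ^ 2)) ^ 2) * (6 * w ^ 2 / (1 + w ^ 2) ^ 3) =
      12 * (c : ℝ) * (1 - w ^ 2) ^ 2 * (7 * (1 + w ^ 2) ^ 2 - (1 - w ^ 2) ^ 2) /
        ((7 * (1 + w ^ 2) ^ 2 - 3 * (1 - w ^ 2) ^ 2) ^ 2 * (1 + w ^ 2)) := by
  have hD : (1 + w ^ 2) ≠ 0 := by positivity
  have hQ : 7 * (1 + w ^ 2) ^ 2 - 3 * (1 - w ^ 2) ^ 2 ≠ 0 := by nlinarith [sq_nonneg w, sq_nonneg (w ^ 2)]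
  have hw2 : (w ^ 2) ≠ 0 := by positivity
  have h1 : 7 - 4 * (3 / 4 * ((1 - w ^ 2) ^ 2 / (1 + w ^ 2) ^ 2)) =
      (7 * (1 + w ^ 2) ^ 2 - 3 * (1 - w ^ 2) ^ 2) / (1 + w ^ 2) ^ 2 := by
    field_simp
  have h2 : 7 - 4 / 3 * (3 / 4 * ((1 - w ^ 2) ^ 2 / (1 + w ^ 2) ^ 2)) =
      (7 * (1 + w ^ 2) ^ 2 - (1 - w ^ 2) ^ 2) / (1 + w ^ 2) ^ 2 := by
    field_simp
  have h3 : 3 / 4 - 3 / 4 * ((1 - w ^ 2) ^ 2 / (1 + w ^ 2) ^ 2) = 3 * w ^ 2 / (1 + w ^ 2) ^ 2 := by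
    field_simp; ring
  rw [E₁, div_pow, h1, h2, h3]
  field_simp
  ring

/-- Along the Euler chart: `E₃·6w²/(1 + w²)³ = 36c·w²(1 − w²)²(7(1 + w²)² − (1 − w²)²)/
((7(1 + w²)² − 3(1 − w²)²)²(1 + w²)³)`. -/
theorem E₃_euler (c : ℚ) {w : ℝ} (hw0 : 0 < w) :
    E₃ c (3 / 4 * ((1 - w ^ 2) / (1 + w ^ 2)) ^ 2) * (6 * w ^ 2 / (1 + w ^ 2) ^ 3) =
      36 * (c : ℝ) * w ^ 2 * (1 - w ^ 2) ^ 2 * (7 * (1 + w ^ 2) ^ 2 - (1 - w ^ 2) ^ 2) /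
        ((7 * (1 + w ^ 2) ^ 2 - 3 * (1 - w ^ 2) ^ 2) ^ 2 * (1 + w ^ 2) ^ 3) := by
  have hD : (1 + w ^ 2) ≠ 0 := by positivity
  have hQ : 7 * (1 + w ^ 2) ^ 2 - 3 * (1 - w ^ 2) ^ 2 ≠ 0 := by nlinarith [sq_nonneg w, sq_nonneg (w ^ 2)]
  have h1 : 7 - 4 * (3 / 4 * ((1 - w ^ 2) ^ 2 / (1 + w ^ 2) ^ 2)) =
      (7 * (1 + w ^ 2) ^ 2 - 3 * (1 - w ^ 2) ^ 2) / (1 + w ^ 2) ^ 2 := by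
    field_simp
  have h2 : 7 - 4 / 3 * (3 / 4 * ((1 - w ^ 2) ^ 2 / (1 + w ^ 2) ^ 2)) =
      (7 * (1 + w ^ 2) ^ 2 - (1 - w ^ 2) ^ 2) / (1 + w ^ 2) ^ 2 := by
    field_simp
  rw [E₃, div_pow, h1, h2]
  field_simp
  ring

/-- **The circle boundary term is in the Baker sector.**  `[W, c·P₃(√β(v))·g(v)]` for `W ⊆ V₁`:
chart `v = v₁(x)` (rule (2); the `√(7 − 4x²)` cancels), then the Euler chart of
`x² + y² = 3/4` (rule (2)). [this node, gen 5] -/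
theorem inBaker_T₁ (c : ℚ) (r : KZ.IntegralRep 1) (hd : r.domain ⊆ V₁)
    (hi : ∀ w ∈ r.domain, r.integrand w = chF c (√(chβ (w 0))) (w 0)) : InBaker (KZ.of r) := by
  -- the pulled-back integrand `E₁(c, x²)·p(x)` is semialgebraic on `T`
  have hR : IsSemialgebraicFunOn ℚ Tq fun x => E₁ c (x 0 ^ 2) * chP (x 0) :=
    ((isSemialgebraicFunOn_aeval_div_aeval isSemialgebraic_Tq
      (MvPolynomial.C (8 * c) * X 0 ^ 2 * (7 - MvPolynomial.C (4 / 3) * X 0 ^ 2))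
      ((7 - 4 * X 0 ^ 2) ^ 2 * (MvPolynomial.C (3 / 4) - X 0 ^ 2)) fun x hx => by
        obtain ⟨-, hx2⟩ := hx
        simp only [map_mul, map_sub, map_pow, MvPolynomial.aeval_C, MvPolynomial.aeval_X, map_ofNat,
          eq_ratCast]
        push_cast
        exact mul_ne_zero (pow_ne_zero 2 (by linarith)) (by linarith)).mul_holds
      isSemialgebraicFunOn_chP_Tq).congr fun x _ => by
        simp only [Pi.mul_apply, map_mul, map_sub, map_pow, MvPolynomial.aeval_C,
          MvPolynomial.aeval_X, map_ofNat, eq_ratCast, E₁]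
        push_cast; ring
  -- the chart `v₁` is semialgebraic on `T`
  have hg : IsSemialgebraicFunOn ℚ Tq fun x => v₁ (x 0) :=
    (((isSemialgebraicFunOn_ratCast isSemialgebraic_Tq 2).mul_holds isSemialgebraicFunOn_chP_Tq).div
      (isSemialgebraicFunOn_chS_Tq.add_holds (isSemialgebraicFunOn_ratCast isSemialgebraic_Tq 2))
      (fun x hx => by
        have h := two_lt_chS hx.2
        simp only [Pi.add_apply]; push_cast; linarith)).congr fun x _ => by
      simp only [Pi.mul_apply, Pi.add_apply, v₁]; push_cast; ring
  obtain ⟨r₁, hr₁d, hr₁i, hrel⟩ := exists_cov₁ r isSemialgebraic_Tq v₁ v₁d hg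
    (fun x hx => hasDerivAt_v₁ hx.2)
    (fun s hs t ht hst => by
      have h : s 0 ^ 2 = t 0 ^ 2 := by rw [← chβ_v₁ hs.2, ← chβ_v₁ ht.2, hst]
      exact (pow_left_inj₀ hs.1.le ht.1.le two_ne_zero).1 h)
    (fun w hw => by
      obtain ⟨⟨hv0, hv1⟩, hβ⟩ := mem_V₁.1 (hd hw)
      refine ⟨fun _ => √(chβ (w 0)), ⟨Real.sqrt_pos.2 hβ, ?_⟩, v₁_sqrt_chβ hv0 hv1 hβ⟩
      show √(chβ (w 0)) ^ 2 < 3 / 4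
      rw [Real.sq_sqrt hβ.le]
      exact chβ_lt hv0.ne' (by nlinarith))
    (fun x => E₁ c (x 0 ^ 2) * chP (x 0)) hR
    (fun x hx hmem => by
      obtain ⟨hx0, hx2⟩ := hx
      rw [hi _ hmem]
      simp only [lift₁_apply]
      rw [chβ_v₁ hx2, Real.sqrt_sq hx0.le, chF,
        show (c : ℝ) * (7 * x 0 - 4 / 3 * x 0 ^ 3) * chG (v₁ (x 0)) * |v₁d (x 0)| =
          (c : ℝ) * (7 * x 0 - 4 / 3 * x 0 ^ 3) * (chG (v₁ (x 0)) * |v₁d (x 0)|) by ring,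
        chG_v₁_mul_abs hx2 hx0, E₁, ← chP_sq hx2.le]
      have hp := chP_pos hx2
      have h7 : (7:ℝ) - 4 * x 0 ^ 2 ≠ 0 := by linarith
      field_simp)
  -- the Euler chart
  have h₁ : InBaker (KZ.of r₁) := by
    refine inBaker_of_euler34 r₁ (E₁ c) (fun x hx => by rw [hr₁d] at hx; exact hx.1)
      (fun x _ => by rw [hr₁i]; rfl)
      (MvPolynomial.C (12 * c) * (1 - X 0 ^ 2) ^ 2 * (7 * (1 + X 0 ^ 2) ^ 2 - (1 - X 0 ^ 2) ^ 2))
      ((7 * (1 + X 0 ^ 2) ^ 2 - 3 * (1 - X 0 ^ 2) ^ 2) ^ 2 * (1 + X 0 ^ 2))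
      (fun w hw => ?_) fun w hw => ?_
    · obtain ⟨hw0, hw1⟩ := mem_unitIoo.1 hw
      simp only [map_mul, map_sub, map_pow, map_add, map_one, MvPolynomial.aeval_X, map_ofNat]
      have hQ : 7 * (1 + w 0 ^ 2) ^ 2 - 3 * (1 - w 0 ^ 2) ^ 2 ≠ 0 := by
        nlinarith [sq_nonneg (w 0), sq_nonneg (w 0 ^ 2)]
      exact mul_ne_zero (pow_ne_zero 2 hQ) (by positivity)
    · obtain ⟨hw0, hw1⟩ := mem_unitIoo.1 hw
      rw [E₁_euler c hw0]
      simp only [map_mul, map_sub, map_pow, map_add, map_one, MvPolynomial.aeval_C,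
        MvPolynomial.aeval_X, map_ofNat, eq_ratCast]
  refine h₁.congr ?_
  have : KZ.of r - KZ.of r₁ = -(KZ.of r₁ - KZ.of r) := by abel
  rw [this]
  exact KZ.relations.neg_mem hrel

/-- **The face boundary term is in the Baker sector.**  `[W, c·P₃(√α(v))·g(v)]` for `W ⊆ V₃`:
chart `v = v₂(x)`, then the Euler chart. [this node, gen 5] -/
theorem inBaker_T₃ (c : ℚ) (r : KZ.IntegralRep 1) (hd : r.domain ⊆ V₃)
    (hi : ∀ w ∈ r.domain, r.integrand w = chF c (√(chα (w 0))) (w 0)) : InBaker (KZ.of r) := by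
  have hR : IsSemialgebraicFunOn ℚ Tq fun x => E₃ c (x 0 ^ 2) * chP (x 0) :=
    ((isSemialgebraicFunOn_aeval_div_aeval isSemialgebraic_Tq
      (MvPolynomial.C (8 * c) * X 0 ^ 2 * (7 - MvPolynomial.C (4 / 3) * X 0 ^ 2))
      ((7 - 4 * X 0 ^ 2) ^ 2) fun x hx => by
        obtain ⟨-, hx2⟩ := hx
        simp only [map_mul, map_sub, map_pow, MvPolynomial.aeval_X, map_ofNat]
        exact pow_ne_zero 2 (by linarith)).mul_holds
      isSemialgebraicFunOn_chP_Tq).congr fun x _ => by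
        simp only [Pi.mul_apply, map_mul, map_sub, map_pow, MvPolynomial.aeval_C,
          MvPolynomial.aeval_X, map_ofNat, eq_ratCast, E₃]
        push_cast; ring
  have hg : IsSemialgebraicFunOn ℚ Tq fun x => v₂ (x 0) :=
    ((isSemialgebraicFunOn_ratCast isSemialgebraic_Tq 2).div
      (isSemialgebraicFunOn_chS_Tq.add_holds
        ((isSemialgebraicFunOn_ratCast isSemialgebraic_Tq 2).mul_holds isSemialgebraicFunOn_chP_Tq))
      (fun x hx => by
        have h := two_lt_chS hx.2
        have hp := chP_pos hx.2
        simp only [Pi.add_apply, Pi.mul_apply]; push_cast; nlinarith)).congr fun x _ => by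
      simp only [Pi.mul_apply, Pi.add_apply, v₂]; push_cast; ring
  obtain ⟨r₁, hr₁d, hr₁i, hrel⟩ := exists_cov₁ r isSemialgebraic_Tq v₂ v₂d hg
    (fun x hx => hasDerivAt_v₂ hx.2)
    (fun s hs t ht hst => by
      have h : s 0 ^ 2 = t 0 ^ 2 := by rw [← chα_v₂ hs.2, ← chα_v₂ ht.2, hst]
      exact (pow_left_inj₀ hs.1.le ht.1.le two_ne_zero).1 h)
    (fun w hw => by
      obtain ⟨⟨hv0, hv1⟩, hα⟩ := mem_V₃.1 (hd hw)
      refine ⟨fun _ => √(chα (w 0)), ⟨Real.sqrt_pos.2 hα, ?_⟩, v₂_sqrt_chα hv0 hv1 hα⟩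
      show √(chα (w 0)) ^ 2 < 3 / 4
      rw [Real.sq_sqrt hα.le]
      exact chα_lt hv0.ne' (by nlinarith))
    (fun x => E₃ c (x 0 ^ 2) * chP (x 0)) hR
    (fun x hx hmem => by
      obtain ⟨hx0, hx2⟩ := hx
      rw [hi _ hmem]
      simp only [lift₁_apply]
      rw [chα_v₂ hx2, Real.sqrt_sq hx0.le, chF,
        show (c : ℝ) * (7 * x 0 - 4 / 3 * x 0 ^ 3) * chG (v₂ (x 0)) * |v₂d (x 0)| =
          (c : ℝ) * (7 * x 0 - 4 / 3 * x 0 ^ 3) * (chG (v₂ (x 0)) * |v₂d (x 0)|) by ring,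
        chG_v₂_mul_abs hx2 hx0, E₃]
      have h7 : (7:ℝ) - 4 * x 0 ^ 2 ≠ 0 := by linarith
      field_simp)
  have h₁ : InBaker (KZ.of r₁) := by
    refine inBaker_of_euler34 r₁ (E₃ c) (fun x hx => by rw [hr₁d] at hx; exact hx.1)
      (fun x _ => by rw [hr₁i]; rfl)
      (MvPolynomial.C (36 * c) * X 0 ^ 2 * (1 - X 0 ^ 2) ^ 2 *
        (7 * (1 + X 0 ^ 2) ^ 2 - (1 - X 0 ^ 2) ^ 2))
      ((7 * (1 + X 0 ^ 2) ^ 2 - 3 * (1 - X 0 ^ 2) ^ 2) ^ 2 * (1 + X 0 ^ 2) ^ 3)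
      (fun w hw => ?_) fun w hw => ?_
    · obtain ⟨hw0, hw1⟩ := mem_unitIoo.1 hw
      simp only [map_mul, map_sub, map_pow, map_add, map_one, MvPolynomial.aeval_X, map_ofNat]
      have hQ : 7 * (1 + w 0 ^ 2) ^ 2 - 3 * (1 - w 0 ^ 2) ^ 2 ≠ 0 := by
        nlinarith [sq_nonneg (w 0), sq_nonneg (w 0 ^ 2)]
      exact mul_ne_zero (pow_ne_zero 2 hQ) (by positivity)
    · obtain ⟨hw0, hw1⟩ := mem_unitIoo.1 hw
      rw [E₃_euler c hw0]
      simp only [map_mul, map_sub, map_pow, map_add, map_one, MvPolynomial.aeval_C,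
        MvPolynomial.aeval_X, map_ofNat, eq_ratCast]
  refine h₁.congr ?_
  have : KZ.of r - KZ.of r₁ = -(KZ.of r₁ - KZ.of r) := by abel
  rw [this]
  exact KZ.relations.neg_mem hrel

/-- `[W, F(1, v) − F(a(v), v)]` is in the Baker sector when `[W, −F(a(v), v)] = [W, F_{−c}(a(v), v)]`
is: the first summand `F(1, v) = (17c/3)·g(v)` is rational. [this node] -/
theorem inBaker_of_chF_one_sub (c : ℚ) (r : KZ.IntegralRep 1) (hb : r.domain ⊆ unitIoo)
    (a : (Fin 1 → ℝ) → ℝ) (hi : ∀ w ∈ r.domain, r.integrand w = chF c 1 (w 0) - chF c (a w) (w 0))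
    (hT : ∀ r' : KZ.IntegralRep 1, r'.domain = r.domain →
      (∀ w ∈ r'.domain, r'.integrand w = chF (-c) (a w) (w 0)) → InBaker (KZ.of r')) :
    InBaker (KZ.of r) := by
  have hbd : Bornology.IsBounded r.domain :=
    (isCompact_Icc (a := (0 : Fin 1 → ℝ)) (b := 1)).isBounded.subset (hb.trans unitIoo_subset_Icc)
  set r₁ : KZ.IntegralRep 1 := bddRep r.domain r.isSemialgebraic_domain hbd (fun w => chF c 1 (w 0))
    (isSemialgebraicFunOn_chF r.isSemialgebraic_domain (isSemialgebraicFunOn_one r.isSemialgebraic_domain) c)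
    (|(c : ℝ)| * 9) (fun w hw => by
      have h := mem_unitIoo.1 (hb hw)
      exact abs_chF_le c zero_le_one le_rfl h.1.le h.2.le) with hr₁
  have h₁ : InBaker (KZ.of r₁) := by
    refine InBaker.of_eqOn_aeval_div r₁ (MvPolynomial.C (c * (17 / 3)) * (1 - X 0 ^ 2) ^ 2)
      ((1 + X 0 ^ 2) ^ 3) (fun w _ => by
        simp only [map_pow, map_add, map_one, MvPolynomial.aeval_X]
        positivity) fun w _ => ?_
    simp only [hr₁, bddRep_integrand, chF, chG, map_mul, map_sub, map_pow, map_add, map_one,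
      MvPolynomial.aeval_C, MvPolynomial.aeval_X, eq_ratCast]
    push_cast; ring
  refine InBaker.of_sub' r r₁ rfl h₁ (hT _ rfl fun w hw => ?_)
  rw [subRep_integrand, hi w hw, hr₁, bddRep_integrand, chF_neg]
  ring

end Summit.KontsevichZagierPeriods.RootDecompWalshStrata.ConicDescent.BallCube

end
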